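import Summits.QuantumFields.BalabanUV.T4Continuum.Support.NE9LinSizeEndPieceGain
import Summits.QuantumFields.BalabanUV.T4Continuum.Support.NE9Lemma1PieceClass

/-!
# NE9LinSizeEndCPiece — E5′-πG-CL / E5′-πβ-CL: the d-currency torus END face of row NE9 AT THE CLASS-RELATIVE PIECE FORM
`cpieceChannel P` — the REPAIR of this lineage's piece-form faces E5′-π / E5′-πG / E5′-πβ under the row owner's located
correction O-ne9p1g24-1 (cell `pub-balaban`, T4-DAG §2 node U3 / §6 NE9; rung (B)+1 on a FIXED finite T⁴; NE9 formalisation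
crew, unit `b2b-balaban-t4-ne9-formalise-leaf-07` gen 4; composition BY NAME of leaf-10-g2's E5′ `NE9LinSizeEnd` (p209889) with
the owner's class-relative S5 leaf `NE9Lemma1PieceClass` (t4-ne9-p1-g24, p212277); nothing of either, nor of this lineage's
`NE9LinSizeEndPiece` (p211212) / `NE9LinSizeEndPieceGain` (p211537), is modified)

HONEST FRAMING (T4-DAG PAGE 1).  Rung (B)+1 = existence and uniqueness of the ε → 0 limit of gauge-invariant observables on a
FIXED finite torus T⁴ — NOT infinite volume, NOT a mass gap, NOT the Clay problem.  NE9 is a cell NEW ESTIMATE, NOT PRINTED and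
NOT discharged here.  DISPLAYED (as binders, never asserted): the class-relative piece binders `PieceZero` / `PieceLocal` /
`CSrcScale` / `PieceAdditiveOn Adm` (linearity of (1.23) in the old term ON THE CLASS) / **`PieceBoundOnG Adm`** (the (1.24)×(1.25)
per-piece bound asked for `H ∈ Adm` under VERBATIM the family-level hypothesis of `ChannelSizeAtStepNN` — PROOF-INTERIOR of [I]
§§3–5 for the general species; proved by the owner's part 2 for the displayed species on the ANALYTIC class), the level counts
`LevelCountsG P.frame`, `Factorises` / `LastCouplingLipschitz` at `cpieceChannel P`, and every activity / geometry / (A″) / (L‴)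
binder of E5′ VERBATIM.  0 `def`, 0 `sorry`, no END re-wired; [I]/[II] locators are TYPE locators (ABSOLUTE RULE);
`FlowStep.BetaPertH`, (B), (B^μ) do not occur.  HONEST DEPENDENCY (verbatim): continuum YM on T⁴ ⇐ BetaPertH ∧ nine spine
estimates (0/9 proved); BetaPertH ⇐ (D1) ∧ (D4) ∧ CAP+tail; G-an2-4 gates asym, D1 and NE2/3/4.

WHY (GAPS O-ne9p1g24-1 / FINDING F-ne9p1g24-1, journal l.8319 / l.8568).  The gen-3 faces of this lineage sit on the gen-23
piece form `NE9Lemma1Counting.PieceData` (pieces `(Bg → ℝ) →+ ℝ`), whose ONE displayed per-piece binder `PieceBound` /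
`PieceBoundG` is CLASS-FREE: it asks the piece OPERATOR to be gain-small on ALL bounded inputs.  For the displayed species — the
fifth-order Taylor remainder of an old term ANALYTIC on 𝔘^c_j ([I] (3.54) p. 280, [II] (1.24) p. 7) — that is FALSE (kernel
witnesses `NE9Lemma1PieceClass.not_pieceBoundG_of_evalDiff`, `NE9PieceBoundOnClass.not_dirRem_gain_on_bounded`).  The gen-3
theorems remain true implications, but their S5 hypothesis cannot be inhabited by the displayed species.  The owner's REPAIR is
the class-relative form `CPieceData` with `PieceBoundOnG Adm`; THIS FILE moves the d-currency END faces onto it.  The gen-3 faces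
are recovered as the instance `P := toC Pc` (§3), so nothing landed is lost and the new faces are strict generalisations.

WHAT IS PROVED (kernel).
§1 **E5′-πG-CL `torus_termSize_ne9_and_fadingMemory_of_linSizeDischargers_cpieceGain`** — E5′ at `T := cpieceChannel P`,
   `wt := weightOf P.frame κ₁ d₀ O1 Kp`, `τ := tauOfG c_Q (agePow ω)`: S3 (`hadd`/`hsum`) and S5 (`hstep`) ON THE CLASS `Adm` by
   `NE9Lemma1PieceClass.sBinders_cpieceG` BY NAME from `PieceZero`, `PieceLocal`, `CSrcScale`, `PieceAdditiveOn Adm`,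
   `PieceBoundOnG Adm`, `LevelCountsG P.frame`; the profile by `NE9Lemma1Gain.profileG`; `hpos` derived.  Conclusion LITERALLY
   E5′-πG's: `TermSize E W κ Nsz ∧ NE9 E W κ (prodModuli ℓ fun _ => μ) ∧ FadingMemory (ℓ/μ) μ (…)`, **`μ = ω + 4·lipbar·(a₁·e^{−a″(ν+1)})·c_Q`**.
§2 **E5′-πβ-CL `…_cpieceHolder`** — the (4.30)-species `ω := L^{−β}`, `β > 0` ([I] (4.18) p. 285, p. 288; rate letter of
   O-ne9p1g23-1), `0 < L^{−β} < 1` by `NE9Lemma1Gain.rpow_neg_pos_lt_one`: **`μ_β = L^{−β} + 4·lipbar·(a₁·e^{−a″(ν+1)})·c_Q`**.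
§3 CONSISTENCY (an `example` whose statement is literally the landed gen-3 E5′-πG): at `P := toC Pc` the class-relative face
   gives back `NE9LinSizeEndPieceGain.torus_termSize_ne9_and_fadingMemory_of_linSizeDischargers_pieceGain` (`cpieceChannel_toC`,
   `pieceZero_toC`, `pieceLocal_toC`, `pieceAdditiveOn_toC`, `pieceBoundOnG_toC_of_pieceBoundG`, `levelCountsG_toC` BY NAME).
§4 N2: the rate letters of §1/§2 are token-identical to E5′-πG/πβ's, so `NE9LinSizeEndPieceGain` §4 (`fade_pieceHolder_iff_log_lt`,
   `fade_pieceHolder_of_kappa_threshold`, `fade_necessary_pieceHolder`, `holderGap_antitone`, `not_fade_at_holder_zero`) applies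
   verbatim — one `example`; no new arithmetic, nothing numeric about β asserted.
DISGUISE TEST: one-history statements about a linear channel of ONE run at the class-relative piece form; S5 is the fading
SOURCE, not NE9.

References (TYPE locators only; nothing printed is a hypothesis): T. Bałaban, CMP **109** (1987) [Balaban1987RG1] (0.23) p. 256,
(0.29)–(0.30) p. 258, (1.18) p. 263, (3.54) p. 280, (4.18) p. 285, p. 288; CMP **116** (1988) [Balaban1988RG2Cluster] (1.23)–(1.29)
pp. 7–8, (1.33)–(1.36) p. 9, (2.27) p. 18, (2.38) p. 20, (2.41) p. 21; R. Kotecký, D. Preiss, CMP **103** (1986) [KoteckyPreiss1986].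
-/

noncomputable section

namespace Summit.QuantumFields.BalabanUV.T4Continuum.NE9LinSizeEndCPiece

open scoped BigOperators
open Metric Set MeasureTheory BoundedContinuousFunction
open Literature.Probability.LatticeModels
open Literature.MathematicalPhysics.QuantumFieldTheory
open Literature.MathematicalPhysics.QuantumFieldTheory.Balaban1983to89
open Literature.MathematicalPhysics.QuantumFieldTheory.Balaban1983to89.T4OutputRate
open Literature.MathematicalPhysics.QuantumFieldTheory.Balaban1983to89.T4ActivityLipschitz
open Literature.MathematicalPhysics.QuantumFieldTheory.Balaban1983to89.T4HistoryLipschitzRecursion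
open Literature.MathematicalPhysics.QuantumFieldTheory.Balaban1983to89.T4HistoryLipschitzOuter
open Literature.MathematicalPhysics.QuantumFieldTheory.Balaban1983to89.T4HistoryLipschitzActivity
open Literature.MathematicalPhysics.QuantumFieldTheory.Balaban1983to89.T4HistoryLipschitzEntropy
open Literature.MathematicalPhysics.QuantumFieldTheory.Balaban1983to89.T4HistoryLipschitzCubeGeometry
open Literature.MathematicalPhysics.QuantumFieldTheory.Balaban1983to89.T4HistoryLipschitzActivity (ClusterGeom)
open Literature.MathematicalPhysics.QuantumFieldTheory.Balaban1983to89.T4HistoryLipschitzSegment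
open Literature.MathematicalPhysics.QuantumFieldTheory.Balaban1983to89.T4HistoryLipschitzLinearSize
open Summit.QuantumFields.BalabanUV.T4Continuum.NE9Lemma1Counting
open Summit.QuantumFields.BalabanUV.T4Continuum.NE9Lemma1Gain
open Summit.QuantumFields.BalabanUV.T4Continuum.NE9Lemma1PieceClass
open Summit.QuantumFields.BalabanUV.T4Continuum.NE9LinSizeEnd
open Summit.QuantumFields.BalabanUV.T4Continuum.NE9LinSizeEndBudget
open Summit.QuantumFields.BalabanUV.T4Continuum.NE9LinSizeEndPieceGain

variable {ν N : ℕ} {C : Carriers} {D : ℕ}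
variable {Bg : Type} {Sp : Type*} [TopologicalSpace Sp] [MeasurableSpace Sp] [OpensMeasurableSpace Sp] {F : Type*}
  [Fintype F] {Ω : Type*} [MeasurableSpace Ω]

/-! ## §1 E5′-πG-CL: E5′ at the class-relative piece form with a general gain -/

section Gain

/-- **E5′-πG-CL — E5′ AT THE CLASS-RELATIVE PIECE FORM WITH A GENERAL GAIN (kernel composition BY NAME; the repair of E5′-πG under
O-ne9p1g24-1).**  `NE9LinSizeEnd.torus_termSize_ne9_and_fadingMemory_of_linSizeDischargers` at `T := cpieceChannel P`,
`wt := weightOf P.frame κ₁ d0 O1 Kp`, `τ := tauOfG cQ (agePow ω)`: S3 and S5 ON THE CLASS `Adm` by `sBinders_cpieceG` from the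
class-relative piece binders `PieceZero` / `PieceLocal` / `CSrcScale` / `PieceAdditiveOn Adm` (linearity of (1.23) in the old term,
on the class) / **`PieceBoundOnG Adm`** (ONE per-piece bound of the (1.24)×(1.25) shape with the gain `(L^jη)^{4+α}` of [I] (0.29),
asked for `H ∈ Adm` under the scale-j family bound) and the counts `LevelCountsG P.frame` (`countQ : card(□′)·gain ≤ c_Q·ω^{k−j}`);
so **`τ̄ = c_Q`** and the contraction letter **`ω`** is a PARAMETER (`0 < ω`); `hpos` derived.  Conclusion: `TermSize` and the root
with rate letter **`μ = ω + 4·lipbar·(a₁·e^{−a″(ν+1)})·c_Q`**.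
[cite: Balaban1987RG1, (0.29)-(0.30) p.258, (3.54) p.280, (4.18) p.285, p.288; Balaban1988RG2Cluster, (1.23)-(1.29) pp.7-8, (1.33) p.9, (2.27) p.18, (2.38) p.20, (2.41) p.21; KoteckyPreiss1986, (1)-(3)] -/
theorem torus_termSize_ne9_and_fadingMemory_of_linSizeDischargers_cpieceGain
    (Γ : CubeChart C (Fin ν → ZMod N) (torusAdj ν N) D) {ι αi βi γi : Type} (P : CPieceData C Bg ι αi βi γi)
    {E : Functional C Bg} {W : Set (ℕ → ℝ)} {Adm : Set (Bg → C.Dom → ℝ)} {Ψ : ℕ → ℝ → (ι → ℝ) → Bg → C.Dom → ℝ}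
    {μ : ℕ → ℝ → Bg → Finset (Fin ν → ZMod N) → Measure Ω} {pre : ℕ → ℝ → Bg → Finset (Fin ν → ZMod N) → Ω → ℂ}
    {c : ℕ → ℝ → Bg → Finset (Fin ν → ZMod N) → Ω → F → ℂ}
    {pt : ℕ → ℝ → Bg → Finset (Fin ν → ZMod N) → Ω → F → Sp} {β : ℕ → Sp → ℝ}
    {dom : ℕ → Finset (Fin ν → ZMod N) → F → Finset (Fin ν → ZMod N)}
    {lip ε' α4 : ℕ → ℝ} {a₁ a'' κ κ₁ d0 O1 cQ ω lipbar ℓ a a' : ℝ} {Kp : ℕ → ι → ℝ} {gain : ℕ → ℕ → ℝ}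
    {lam p₀ Nsz : ℕ → ℝ}
    (ρ : ℕ → (ι → ℝ) → (Sp →ᵇ ℂ))
    (h0 : ScaleZeroFree E W) (hAdm : AdmissibleTerms E W Adm) (hres : AdmRestrict Adm)
    -- the class-relative piece form with a general gain: structure binders, ONE per-piece bound ON THE CLASS, the level counts
    (h0P : PieceZero P) (hloc : PieceLocal P) (hsrc : CSrcScale P) (hA : PieceAdditiveOn Adm P)
    (hPiece : PieceBoundOnG Adm P κ κ₁ d0 Kp gain) (hLev : LevelCountsG P.frame κ κ₁ O1 cQ gain (agePow ω))
    (hKp : ∀ k y, 0 ≤ Kp k y) (hO1 : 0 ≤ O1) (hgain : ∀ k j, 0 ≤ gain k j) (hcQ : 0 ≤ cQ) (hω : 0 < ω)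
    -- E5′'s remaining recursion-side binders at `T := cpieceChannel P`, `wt := weightOf P.frame …`, `τ := tauOfG cQ (agePow ω)`
    (hfac : Factorises E W (cpieceChannel P) Ψ) (hlast : LastCouplingLipschitz E W (cpieceChannel P) Ψ κ lam)
    (hρ : ∀ (k : ℕ) (Q Q' : ι → ℝ) (M : ℝ), (∀ y, |Q y - Q' y| ≤ weightOf P.frame κ₁ d0 O1 Kp k y * M) →
      ‖ρ k Q - ρ k Q'‖ ≤ M)
    (hΨ : ∀ (k : ℕ) (s : ℝ) (Q Q' : ι → ℝ) (U : Bg) (X : C.Dom),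
      Ψ k s Q U X - Ψ k s Q' U X =
        (Γ.geom.newTerm (Γ.geom.avgExpLinearAct μ pre fun k s U γ ω => evalFunctional (c k s U γ ω) (pt k s U γ ω))
            k s U X (ρ k Q) -
          Γ.geom.newTerm (Γ.geom.avgExpLinearAct μ pre fun k s U γ ω => evalFunctional (c k s U γ ω) (pt k s U γ ω))
            k s U X (ρ k Q')).re)
    (hexpl : ∀ g ∈ W, ∀ (k : ℕ) (Q : ι → ℝ) (U : Bg) (X : C.Dom), C.scale X = k + 1 →
      |Ψ k (g k) Q U X -
          (Γ.geom.newTerm (Γ.geom.avgExpLinearAct μ pre fun k s U γ ω => evalFunctional (c k s U γ ω) (pt k s U γ ω))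
            k (g k) U X (ρ k Q)).re| ≤ Real.exp (-(κ * C.d X)) * p₀ k)
    (hbase : ∀ g ∈ W, ∀ (U : Bg) (X : C.Dom), C.scale X = 0 → |E g U X| ≤ Real.exp (-(κ * C.d X)) * Nsz 0)
    (hNsucc : ∀ j, p₀ j + a₁ * Real.exp (-(a'' * (ν + 1))) ≤ Nsz (j + 1)) (hNnn : ∀ j, 0 ≤ Nsz j)
    (hbox : ∀ (k : ℕ) (Q : ι → ℝ),
      (∀ y, |Q y| ≤ weightOf P.frame κ₁ d0 O1 Kp k y * sizeRadius (tauOfG cQ (agePow ω)) Nsz k) → ∀ x, ‖ρ k Q x‖ ≤ β k x)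
    (hpre : ∀ k s U γ, AEStronglyMeasurable (pre k s U γ) (μ k s U γ))
    (hc : ∀ k s U γ Y, AEStronglyMeasurable (fun ω => c k s U γ ω Y) (μ k s U γ))
    (hpt : ∀ k s U γ Y, Measurable fun ω => pt k s U γ ω Y) (hlip : ∀ k, 0 < lip k) (hlipb : ∀ k, lip k ≤ lipbar)
    (hint₀ : ∀ k s U γ, Integrable (fun ω => ‖pre k s U γ ω‖ * Real.exp (boxExponent c pt β k s U γ ω)) (μ k s U γ))
    (hmeet : ∀ k s U (γ : Finset (Fin ν → ZMod N)) ω Y, c k s U γ ω Y ≠ 0 → ∃ x ∈ γ, x ∈ dom k γ Y)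
    (hα4 : ∀ k, 0 ≤ α4 k) (ha : (2:ℝ) ^ ν * Real.log 2 + Real.log (8 * ν) ≤ a)
    (hliplb : ∀ k, α4 k * 2 ^ (ν + 1 + 2 ^ ν) ≤ lip k)
    (hlin : ∀ k s U (γ : Finset (Fin ν → ZMod N)) ω Y,
      ‖c k s U γ ω Y‖ ≤ α4 k * Real.exp (-(a * (linSize (dom k γ Y) : ℝ))))
    (hdomconn : ∀ k (γ : Finset (Fin ν → ZMod N)) Y, (dom k γ Y).Nonempty →
      ∃ b ∈ dom k γ Y, Polymer.IsConn (torusAdj ν N) (dom k γ Y) b)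
    (hdominj : ∀ k (γ : Finset (Fin ν → ZMod N)), Set.InjOn (dom k γ) {Y | (dom k γ Y).Nonempty})
    (hXconn : ∀ X, ∃ b, Polymer.IsConn (torusAdj ν N) (Γ.cubes X) b)
    (hcmp : ∀ X, κ * C.d X ≤ a'' * (linSize (Γ.cubes X) : ℝ))
    (hε' : ∀ k, 0 ≤ ε' k)
    (hdecayLin : ∀ g ∈ W, ∀ (k : ℕ) (U : Bg) (X : C.Dom), C.scale X = k + 1 → ∀ γ' ∈ Γ.vol X,
      ∫ ω, ‖pre k (g k) U γ' ω‖ * Real.exp (boxExponent c pt β k (g k) U γ' ω) ∂(μ k (g k) U γ') ≤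
        ε' k * Real.exp (-(a' * (linSize γ' : ℝ))))
    (ha₁ : 0 ≤ a₁) (ha'' : 0 ≤ a'')
    (hrate : (2:ℝ) ^ ν * Real.log 2 + Real.log (8 * ν) ≤ a' - a'' - 2 ^ ν * (a₁ + Real.log 2))
    (hsmall : ∀ k, ((D : ℝ) + 1) * (2 * ε' k) * Real.exp (a'' * (ν + 1) + 2 ^ ν * (a₁ + Real.log 2)) *
      2 ^ (ν + 1 + 2 ^ ν) ≤ a₁)
    (hℓ : 0 ≤ ℓ) (hlam : ∀ k, lam k ≤ ℓ) :
    TermSize E W κ Nsz ∧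
      NE9 E W κ (prodModuli ℓ fun _ => ω + 4 * lipbar * (a₁ * Real.exp (-(a'' * (ν + 1)))) * cQ) ∧
        FadingMemory (ℓ / (ω + 4 * lipbar * (a₁ * Real.exp (-(a'' * (ν + 1)))) * cQ))
          (ω + 4 * lipbar * (a₁ * Real.exp (-(a'' * (ν + 1)))) * cQ)
          (prodModuli ℓ fun _ => ω + 4 * lipbar * (a₁ * Real.exp (-(a'' * (ν + 1)))) * cQ) := by
  have hlipbar : 0 ≤ lipbar := (hlip 0).le.trans (hlipb 0)
  have hpos : 0 < ω + 4 * lipbar * (a₁ * Real.exp (-(a'' * (ν + 1)))) * cQ := by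
    have h2 : 0 ≤ 4 * lipbar * (a₁ * Real.exp (-(a'' * (ν + 1)))) * cQ := by positivity
    linarith
  have hcQℓ : ∀ k j, 0 ≤ cQ * agePow ω k j := fun k j => mul_nonneg hcQ (agePow_nonneg hω.le k j)
  -- the four S-binders ON THE CLASS `Adm` at the class-relative piece form, and the α-profile
  have hS := sBinders_cpieceG h0P hloc hsrc hA hPiece hLev hKp hO1 hgain hcQℓ
  have hprof := profileG hcQ hω.le
  exact torus_termSize_ne9_and_fadingMemory_of_linSizeDischargers Γ ρ h0 hAdm hres hS.1 hS.2.2.1 hS.2.2.2 hfac hlast hρ hΨ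
    hexpl hbase hNsucc hNnn hbox hpre hc hpt hlip hlipb hint₀ hmeet hα4 ha hliplb hlin hdomconn hdominj hXconn hcmp hε' hdecayLin
    ha₁ ha'' hrate hsmall hℓ hcQ hω.le hpos hlam (fun k j hjk => ⟨hcQℓ k j, hprof.1 k j hjk⟩)

/-! ## §2 E5′-πβ-CL: the (4.30)-species `ω = L^{−β}` -/

/-- **E5′-πβ-CL — THE (4.30)-SPECIES AT THE CLASS-RELATIVE PIECE FORM: `ω = L^{−β}`, `β > 0` THE HÖLDER EXPONENT OF [I]
(3.32)/(4.18)** (owner ruling l.7710 (E) / O-ne9p1g23-1: «RATE LETTER ω := L^{−α} (α = β < 1 for the (4.30)-species), NOT L⁻¹»;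
[I] p. 288 «with a positive β … the power 4 + β instead of 5»; (0.30) «≦ O(1)(1 − L^{−α})⁻¹»): §1 at `ω := L^{−β}` (real power),
`0 < L^{−β} < 1` by `NE9Lemma1Gain.rpow_neg_pos_lt_one`.  Rate letter **`μ_β = L^{−β} + 4·lipbar·(a₁·e^{−a″(ν+1)})·c_Q`** — E5′-πβ's,
token for token. [cite: Balaban1987RG1, (0.29)-(0.30) p.258, (4.18) p.285, p.288; Balaban1988RG2Cluster, (1.24)-(1.25) p.7, p.8] -/
theorem torus_termSize_ne9_and_fadingMemory_of_linSizeDischargers_cpieceHolder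
    (Γ : CubeChart C (Fin ν → ZMod N) (torusAdj ν N) D) {ι αi βi γi : Type} (P : CPieceData C Bg ι αi βi γi)
    {E : Functional C Bg} {W : Set (ℕ → ℝ)} {Adm : Set (Bg → C.Dom → ℝ)} {Ψ : ℕ → ℝ → (ι → ℝ) → Bg → C.Dom → ℝ}
    {μ : ℕ → ℝ → Bg → Finset (Fin ν → ZMod N) → Measure Ω} {pre : ℕ → ℝ → Bg → Finset (Fin ν → ZMod N) → Ω → ℂ}
    {c : ℕ → ℝ → Bg → Finset (Fin ν → ZMod N) → Ω → F → ℂ}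
    {pt : ℕ → ℝ → Bg → Finset (Fin ν → ZMod N) → Ω → F → Sp} {β : ℕ → Sp → ℝ}
    {dom : ℕ → Finset (Fin ν → ZMod N) → F → Finset (Fin ν → ZMod N)}
    {lip ε' α4 : ℕ → ℝ} {a₁ a'' κ κ₁ d0 O1 cQ L βg lipbar ℓ a a' : ℝ} {Kp : ℕ → ι → ℝ} {gain : ℕ → ℕ → ℝ}
    {lam p₀ Nsz : ℕ → ℝ}
    (ρ : ℕ → (ι → ℝ) → (Sp →ᵇ ℂ))
    (h0 : ScaleZeroFree E W) (hAdm : AdmissibleTerms E W Adm) (hres : AdmRestrict Adm)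
    -- the (4.30)-species: block size L > 1, Hölder exponent β > 0, gain counted against `c_Q·(L^{−β})^{k−j}`, ON THE CLASS `Adm`
    (hL1 : 1 < L) (hβ : 0 < βg) (h0P : PieceZero P) (hloc : PieceLocal P) (hsrc : CSrcScale P) (hA : PieceAdditiveOn Adm P)
    (hPiece : PieceBoundOnG Adm P κ κ₁ d0 Kp gain) (hLev : LevelCountsG P.frame κ κ₁ O1 cQ gain (agePow (L ^ (-βg))))
    (hKp : ∀ k y, 0 ≤ Kp k y) (hO1 : 0 ≤ O1) (hgain : ∀ k j, 0 ≤ gain k j) (hcQ : 0 ≤ cQ)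
    -- E5′'s remaining recursion-side binders at `T := cpieceChannel P`, `τ := tauOfG cQ (agePow (L^{−β}))`
    (hfac : Factorises E W (cpieceChannel P) Ψ) (hlast : LastCouplingLipschitz E W (cpieceChannel P) Ψ κ lam)
    (hρ : ∀ (k : ℕ) (Q Q' : ι → ℝ) (M : ℝ), (∀ y, |Q y - Q' y| ≤ weightOf P.frame κ₁ d0 O1 Kp k y * M) →
      ‖ρ k Q - ρ k Q'‖ ≤ M)
    (hΨ : ∀ (k : ℕ) (s : ℝ) (Q Q' : ι → ℝ) (U : Bg) (X : C.Dom),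
      Ψ k s Q U X - Ψ k s Q' U X =
        (Γ.geom.newTerm (Γ.geom.avgExpLinearAct μ pre fun k s U γ ω => evalFunctional (c k s U γ ω) (pt k s U γ ω))
            k s U X (ρ k Q) -
          Γ.geom.newTerm (Γ.geom.avgExpLinearAct μ pre fun k s U γ ω => evalFunctional (c k s U γ ω) (pt k s U γ ω))
            k s U X (ρ k Q')).re)
    (hexpl : ∀ g ∈ W, ∀ (k : ℕ) (Q : ι → ℝ) (U : Bg) (X : C.Dom), C.scale X = k + 1 →
      |Ψ k (g k) Q U X -
          (Γ.geom.newTerm (Γ.geom.avgExpLinearAct μ pre fun k s U γ ω => evalFunctional (c k s U γ ω) (pt k s U γ ω))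
            k (g k) U X (ρ k Q)).re| ≤ Real.exp (-(κ * C.d X)) * p₀ k)
    (hbase : ∀ g ∈ W, ∀ (U : Bg) (X : C.Dom), C.scale X = 0 → |E g U X| ≤ Real.exp (-(κ * C.d X)) * Nsz 0)
    (hNsucc : ∀ j, p₀ j + a₁ * Real.exp (-(a'' * (ν + 1))) ≤ Nsz (j + 1)) (hNnn : ∀ j, 0 ≤ Nsz j)
    (hbox : ∀ (k : ℕ) (Q : ι → ℝ),
      (∀ y, |Q y| ≤ weightOf P.frame κ₁ d0 O1 Kp k y * sizeRadius (tauOfG cQ (agePow (L ^ (-βg)))) Nsz k) →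
        ∀ x, ‖ρ k Q x‖ ≤ β k x)
    (hpre : ∀ k s U γ, AEStronglyMeasurable (pre k s U γ) (μ k s U γ))
    (hc : ∀ k s U γ Y, AEStronglyMeasurable (fun ω => c k s U γ ω Y) (μ k s U γ))
    (hpt : ∀ k s U γ Y, Measurable fun ω => pt k s U γ ω Y) (hlip : ∀ k, 0 < lip k) (hlipb : ∀ k, lip k ≤ lipbar)
    (hint₀ : ∀ k s U γ, Integrable (fun ω => ‖pre k s U γ ω‖ * Real.exp (boxExponent c pt β k s U γ ω)) (μ k s U γ))
    (hmeet : ∀ k s U (γ : Finset (Fin ν → ZMod N)) ω Y, c k s U γ ω Y ≠ 0 → ∃ x ∈ γ, x ∈ dom k γ Y)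
    (hα4 : ∀ k, 0 ≤ α4 k) (ha : (2:ℝ) ^ ν * Real.log 2 + Real.log (8 * ν) ≤ a)
    (hliplb : ∀ k, α4 k * 2 ^ (ν + 1 + 2 ^ ν) ≤ lip k)
    (hlin : ∀ k s U (γ : Finset (Fin ν → ZMod N)) ω Y,
      ‖c k s U γ ω Y‖ ≤ α4 k * Real.exp (-(a * (linSize (dom k γ Y) : ℝ))))
    (hdomconn : ∀ k (γ : Finset (Fin ν → ZMod N)) Y, (dom k γ Y).Nonempty →
      ∃ b ∈ dom k γ Y, Polymer.IsConn (torusAdj ν N) (dom k γ Y) b)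
    (hdominj : ∀ k (γ : Finset (Fin ν → ZMod N)), Set.InjOn (dom k γ) {Y | (dom k γ Y).Nonempty})
    (hXconn : ∀ X, ∃ b, Polymer.IsConn (torusAdj ν N) (Γ.cubes X) b)
    (hcmp : ∀ X, κ * C.d X ≤ a'' * (linSize (Γ.cubes X) : ℝ))
    (hε' : ∀ k, 0 ≤ ε' k)
    (hdecayLin : ∀ g ∈ W, ∀ (k : ℕ) (U : Bg) (X : C.Dom), C.scale X = k + 1 → ∀ γ' ∈ Γ.vol X,
      ∫ ω, ‖pre k (g k) U γ' ω‖ * Real.exp (boxExponent c pt β k (g k) U γ' ω) ∂(μ k (g k) U γ') ≤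
        ε' k * Real.exp (-(a' * (linSize γ' : ℝ))))
    (ha₁ : 0 ≤ a₁) (ha'' : 0 ≤ a'')
    (hrate : (2:ℝ) ^ ν * Real.log 2 + Real.log (8 * ν) ≤ a' - a'' - 2 ^ ν * (a₁ + Real.log 2))
    (hsmall : ∀ k, ((D : ℝ) + 1) * (2 * ε' k) * Real.exp (a'' * (ν + 1) + 2 ^ ν * (a₁ + Real.log 2)) *
      2 ^ (ν + 1 + 2 ^ ν) ≤ a₁)
    (hℓ : 0 ≤ ℓ) (hlam : ∀ k, lam k ≤ ℓ) :
    TermSize E W κ Nsz ∧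
      NE9 E W κ (prodModuli ℓ fun _ => L ^ (-βg) + 4 * lipbar * (a₁ * Real.exp (-(a'' * (ν + 1)))) * cQ) ∧
        FadingMemory (ℓ / (L ^ (-βg) + 4 * lipbar * (a₁ * Real.exp (-(a'' * (ν + 1)))) * cQ))
          (L ^ (-βg) + 4 * lipbar * (a₁ * Real.exp (-(a'' * (ν + 1)))) * cQ)
          (prodModuli ℓ fun _ => L ^ (-βg) + 4 * lipbar * (a₁ * Real.exp (-(a'' * (ν + 1)))) * cQ) :=
  torus_termSize_ne9_and_fadingMemory_of_linSizeDischargers_cpieceGain Γ P ρ h0 hAdm hres h0P hloc hsrc hA hPiece hLev hKp hO1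
    hgain hcQ (rpow_neg_pos_lt_one hL1 hβ).1 hfac hlast hρ hΨ hexpl hbase hNsucc hNnn hbox hpre hc hpt hlip hlipb hint₀ hmeet hα4
    ha hliplb hlin hdomconn hdominj hXconn hcmp hε' hdecayLin ha₁ ha'' hrate hsmall hℓ hlam

end Gain

/-! ## §3 Consistency: the gen-3 class-free face E5′-πG is the instance `P := toC Pc` -/

section Consistency

/-- CONSISTENCY (an `example`, the statement being literally the landed E5′-πG
`NE9LinSizeEndPieceGain.torus_termSize_ne9_and_fadingMemory_of_linSizeDischargers_pieceGain`): the gen-3 class-free face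
re-derived from §1 at `P := toC Pc` — `cpieceChannel (toC Pc) = pieceChannel Pc` and `weightOf (toC Pc).frame = weightOf Pc`
definitionally, `PieceZero` / `PieceLocal` / `PieceAdditiveOn Adm` automatic for the embedded form, `CSrcScale (toC Pc)` is
`SrcScale Pc`, and the class-free `PieceBoundG` implies `PieceBoundOnG Adm (toC Pc)` on every class
(`pieceBoundOnG_toC_of_pieceBoundG`).  Nothing landed is lost; §1 is a strict generalisation. [folklore] -/
example (Γ : CubeChart C (Fin ν → ZMod N) (torusAdj ν N) D) {ι αi βi γi : Type} (Pc : PieceData C Bg ι αi βi γi)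
    {E : Functional C Bg} {W : Set (ℕ → ℝ)} {Adm : Set (Bg → C.Dom → ℝ)} {Ψ : ℕ → ℝ → (ι → ℝ) → Bg → C.Dom → ℝ}
    {μ : ℕ → ℝ → Bg → Finset (Fin ν → ZMod N) → Measure Ω} {pre : ℕ → ℝ → Bg → Finset (Fin ν → ZMod N) → Ω → ℂ}
    {c : ℕ → ℝ → Bg → Finset (Fin ν → ZMod N) → Ω → F → ℂ}
    {pt : ℕ → ℝ → Bg → Finset (Fin ν → ZMod N) → Ω → F → Sp} {β : ℕ → Sp → ℝ}
    {dom : ℕ → Finset (Fin ν → ZMod N) → F → Finset (Fin ν → ZMod N)}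
    {lip ε' α4 : ℕ → ℝ} {a₁ a'' κ κ₁ d0 O1 cQ ω lipbar ℓ a a' : ℝ} {Kp : ℕ → ι → ℝ} {gain : ℕ → ℕ → ℝ}
    {lam p₀ Nsz : ℕ → ℝ}
    (ρ : ℕ → (ι → ℝ) → (Sp →ᵇ ℂ))
    (h0 : ScaleZeroFree E W) (hAdm : AdmissibleTerms E W Adm) (hres : AdmRestrict Adm)
    (hsrc : SrcScale Pc) (hPiece : PieceBoundG Pc κ κ₁ d0 Kp gain) (hLev : LevelCountsG Pc κ κ₁ O1 cQ gain (agePow ω))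
    (hKp : ∀ k y, 0 ≤ Kp k y) (hO1 : 0 ≤ O1) (hgain : ∀ k j, 0 ≤ gain k j) (hcQ : 0 ≤ cQ) (hω : 0 < ω)
    (hfac : Factorises E W (pieceChannel Pc) Ψ) (hlast : LastCouplingLipschitz E W (pieceChannel Pc) Ψ κ lam)
    (hρ : ∀ (k : ℕ) (Q Q' : ι → ℝ) (M : ℝ), (∀ y, |Q y - Q' y| ≤ weightOf Pc κ₁ d0 O1 Kp k y * M) → ‖ρ k Q - ρ k Q'‖ ≤ M)
    (hΨ : ∀ (k : ℕ) (s : ℝ) (Q Q' : ι → ℝ) (U : Bg) (X : C.Dom),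
      Ψ k s Q U X - Ψ k s Q' U X =
        (Γ.geom.newTerm (Γ.geom.avgExpLinearAct μ pre fun k s U γ ω => evalFunctional (c k s U γ ω) (pt k s U γ ω))
            k s U X (ρ k Q) -
          Γ.geom.newTerm (Γ.geom.avgExpLinearAct μ pre fun k s U γ ω => evalFunctional (c k s U γ ω) (pt k s U γ ω))
            k s U X (ρ k Q')).re)
    (hexpl : ∀ g ∈ W, ∀ (k : ℕ) (Q : ι → ℝ) (U : Bg) (X : C.Dom), C.scale X = k + 1 →
      |Ψ k (g k) Q U X -
          (Γ.geom.newTerm (Γ.geom.avgExpLinearAct μ pre fun k s U γ ω => evalFunctional (c k s U γ ω) (pt k s U γ ω))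
            k (g k) U X (ρ k Q)).re| ≤ Real.exp (-(κ * C.d X)) * p₀ k)
    (hbase : ∀ g ∈ W, ∀ (U : Bg) (X : C.Dom), C.scale X = 0 → |E g U X| ≤ Real.exp (-(κ * C.d X)) * Nsz 0)
    (hNsucc : ∀ j, p₀ j + a₁ * Real.exp (-(a'' * (ν + 1))) ≤ Nsz (j + 1)) (hNnn : ∀ j, 0 ≤ Nsz j)
    (hbox : ∀ (k : ℕ) (Q : ι → ℝ),
      (∀ y, |Q y| ≤ weightOf Pc κ₁ d0 O1 Kp k y * sizeRadius (tauOfG cQ (agePow ω)) Nsz k) → ∀ x, ‖ρ k Q x‖ ≤ β k x)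
    (hpre : ∀ k s U γ, AEStronglyMeasurable (pre k s U γ) (μ k s U γ))
    (hc : ∀ k s U γ Y, AEStronglyMeasurable (fun ω => c k s U γ ω Y) (μ k s U γ))
    (hpt : ∀ k s U γ Y, Measurable fun ω => pt k s U γ ω Y) (hlip : ∀ k, 0 < lip k) (hlipb : ∀ k, lip k ≤ lipbar)
    (hint₀ : ∀ k s U γ, Integrable (fun ω => ‖pre k s U γ ω‖ * Real.exp (boxExponent c pt β k s U γ ω)) (μ k s U γ))
    (hmeet : ∀ k s U (γ : Finset (Fin ν → ZMod N)) ω Y, c k s U γ ω Y ≠ 0 → ∃ x ∈ γ, x ∈ dom k γ Y)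
    (hα4 : ∀ k, 0 ≤ α4 k) (ha : (2:ℝ) ^ ν * Real.log 2 + Real.log (8 * ν) ≤ a)
    (hliplb : ∀ k, α4 k * 2 ^ (ν + 1 + 2 ^ ν) ≤ lip k)
    (hlin : ∀ k s U (γ : Finset (Fin ν → ZMod N)) ω Y,
      ‖c k s U γ ω Y‖ ≤ α4 k * Real.exp (-(a * (linSize (dom k γ Y) : ℝ))))
    (hdomconn : ∀ k (γ : Finset (Fin ν → ZMod N)) Y, (dom k γ Y).Nonempty →
      ∃ b ∈ dom k γ Y, Polymer.IsConn (torusAdj ν N) (dom k γ Y) b)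
    (hdominj : ∀ k (γ : Finset (Fin ν → ZMod N)), Set.InjOn (dom k γ) {Y | (dom k γ Y).Nonempty})
    (hXconn : ∀ X, ∃ b, Polymer.IsConn (torusAdj ν N) (Γ.cubes X) b)
    (hcmp : ∀ X, κ * C.d X ≤ a'' * (linSize (Γ.cubes X) : ℝ))
    (hε' : ∀ k, 0 ≤ ε' k)
    (hdecayLin : ∀ g ∈ W, ∀ (k : ℕ) (U : Bg) (X : C.Dom), C.scale X = k + 1 → ∀ γ' ∈ Γ.vol X,
      ∫ ω, ‖pre k (g k) U γ' ω‖ * Real.exp (boxExponent c pt β k (g k) U γ' ω) ∂(μ k (g k) U γ') ≤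
        ε' k * Real.exp (-(a' * (linSize γ' : ℝ))))
    (ha₁ : 0 ≤ a₁) (ha'' : 0 ≤ a'')
    (hrate : (2:ℝ) ^ ν * Real.log 2 + Real.log (8 * ν) ≤ a' - a'' - 2 ^ ν * (a₁ + Real.log 2))
    (hsmall : ∀ k, ((D : ℝ) + 1) * (2 * ε' k) * Real.exp (a'' * (ν + 1) + 2 ^ ν * (a₁ + Real.log 2)) *
      2 ^ (ν + 1 + 2 ^ ν) ≤ a₁)
    (hℓ : 0 ≤ ℓ) (hlam : ∀ k, lam k ≤ ℓ) :
    TermSize E W κ Nsz ∧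
      NE9 E W κ (prodModuli ℓ fun _ => ω + 4 * lipbar * (a₁ * Real.exp (-(a'' * (ν + 1)))) * cQ) ∧
        FadingMemory (ℓ / (ω + 4 * lipbar * (a₁ * Real.exp (-(a'' * (ν + 1)))) * cQ))
          (ω + 4 * lipbar * (a₁ * Real.exp (-(a'' * (ν + 1)))) * cQ)
          (prodModuli ℓ fun _ => ω + 4 * lipbar * (a₁ * Real.exp (-(a'' * (ν + 1)))) * cQ) := by
  have hsrc' : CSrcScale (toC Pc) := hsrc
  exact torus_termSize_ne9_and_fadingMemory_of_linSizeDischargers_cpieceGain Γ (toC Pc) ρ h0 hAdm hres (pieceZero_toC Pc)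
    (pieceLocal_toC Pc) hsrc' (pieceAdditiveOn_toC Pc Adm) (pieceBoundOnG_toC_of_pieceBoundG hsrc hPiece Adm)
    (levelCountsG_toC hLev) hKp hO1 hgain hcQ hω hfac hlast hρ hΨ hexpl hbase hNsucc hNnn hbox hpre hc hpt hlip hlipb hint₀
    hmeet hα4 ha hliplb hlin hdomconn hdominj hXconn hcmp hε' hdecayLin ha₁ ha'' hrate hsmall hℓ hlam

end Consistency

/-! ## §4 Leaf N2: the letters are E5′-πG/πβ's, so `NE9LinSizeEndPieceGain` §4 applies verbatim -/

/-- N2 ON E5′-πβ-CL IS N2 ON E5′-πβ (an `example`; the rate letter `L^{−β} + 4·lipbar·(a₁·e^{−a″(ν+1)})·c_Q` of §2 is E5′-πβ's token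
for token, so `fade_pieceHolder_iff_log_lt` — and likewise `fade_pieceHolder_of_kappa_threshold`, `fade_necessary_pieceHolder`,
`holderGap_antitone`, `not_fade_at_holder_zero` — apply BY NAME; the certified β-tables are the (w6) AMENDMENT's
`NE9FadingArithmeticHolder`; nothing numeric about β is asserted). [folklore] -/
example {ν : ℕ} {L βg lipbar a₁ a'' cQ : ℝ} (hL : 1 < L) (hβ : 0 < βg) (hlip : 0 < lipbar) (ha₁ : 0 < a₁) (hcQ : 0 < cQ) :
    L ^ (-βg) + 4 * lipbar * (a₁ * Real.exp (-(a'' * (ν + 1)))) * cQ < 1 ↔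
      Real.log (4 * lipbar * a₁ * cQ / (1 - L ^ (-βg))) < a'' * (ν + 1) :=
  fade_pieceHolder_iff_log_lt hL hβ hlip ha₁ hcQ

end Summit.QuantumFields.BalabanUV.T4Continuum.NE9LinSizeEndCPiece

end
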